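import Summits.ResolutionOfSingularities.ResolutionOfSingularities.Theorems.PlanarGhostDescentStates
import HarnessLib

/-!
# PlanarGhostDescentStatesB — decomp-res node «GhostDescent» (lens-5 g27, critic row 183 CLEARED DECIDED +1 · MAP
0), tree file 2/3 of the node

Content VERBATIM from the decomp-res lens-5 g27 node `HOME/decomp-res-lens-5/g27/PlanarGhostDescent.lean` (pin
53b88513); imports the landed tree only, carries nothing;
HOME = run/shared/lean/pub/decomp-res; critic row 183 CLEARED DECIDED +1 · MAP 0; landing orders INBOX :923/:931 —
provenance, critic text and the lens header in full in the first file of the node,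
`PlanarGhostDescentStates`.  Namespace `…Theorems.GhostDescent`; `--supports stmt-ResolutionOfSingularities-31770`.

## This file

Continuation 2/2 of `PlanarGhostDescentStates` (same sections of the node, cut at the 400-line cap): carries
`exists_low_exponent_zero`, `sm_zero_step_le`, `sm_zero_step_step_le`, `fat_of_heavy_layer_zero`.

[WRITER NOTE (decomp-res writer g11): file split only (tree files ≤ 400 lines); `noncomputable section`, namespace,
sections, section variables, the `open` lines and every
declaration exactly as in the lens; no instance, no notation, no include/omit added.]

(Sources: Hauser2010Kangaroo §F; HauserPerlega2019; HauserPerlega2024; Moh1987; CossartPiltant2008;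
CossartJannsenSaito2020 Ch. 6.)
-/

noncomputable section

open MvPolynomial Finset
open Literature.AlgebraicGeometry.Resolution
open Literature.AlgebraicGeometry.Resolution.Hauser2010
open Literature.AlgebraicGeometry.Resolution.PointBlowup
open Literature.AlgebraicGeometry.Resolution.WeightedBlowup
open Summit.ResolutionOfSingularities.ResolutionOfSingularities.Theses
open Summit.ResolutionOfSingularities.ResolutionOfSingularities.Theorems.TightDefectClasses
open Summit.ResolutionOfSingularities.ResolutionOfSingularities.Theorems.TightDefectStrongWalks
open Summit.ResolutionOfSingularities.ResolutionOfSingularities.Theorems.ItineraryCutClasses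
open Summit.ResolutionOfSingularities.ResolutionOfSingularities.Theorems.ProximityCut
open Summit.ResolutionOfSingularities.ResolutionOfSingularities.Theorems.ExitLaw
open Summit.ResolutionOfSingularities.ResolutionOfSingularities.Theorems.PlanarCut
open Summit.ResolutionOfSingularities.ResolutionOfSingularities.Theorems.CoefficientCut

namespace Summit.ResolutionOfSingularities.ResolutionOfSingularities.Theorems.GhostDescent

section Planar

variable {K : Type} [Field K] [DecidableEq K]
variable {i j k : Fin 3} (hij : i ≠ j) (hjk : j ≠ k) (hik : i ≠ k)
include hij hjk hik

/-- **KEY LEMMA FOR THE WALL LAYER `0` (PROVED): the lowest new row carries a monomial of small `u_i`-exponent** —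
exactly `PlanarCut.exists_low_exponent` with `a = 0`, for a CLEANED state, PROVIDED a translated move (`b_i ≠ 0`)
happens at `q < n₀ < 2q` (`n₀` = least degree of the layer): then the lowest new row `u_j^{n₀−q}` has
`0 < n₀ − q < q`, none of its exponents is a `q`-th power, and the cleaning does not touch it.  (Untranslated: the
layer is transported bijectively, `chartExponent_mem_layer_step_of_clean`.) [new] [folklore] -/
theorem exists_low_exponent_zero (q : ℕ) (b : Fin 3 → K) (hbj : b j = 0) (hbk : b k = 0) (s : State (Fin 3) K)
    (hF : ∀ d ∈ s.F.support, q ≤ d.degree) (hclean : deletePthPowers q s.F = s.F)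
    (hrange : b i ≠ 0 → q < loSum (layer k 0 s.F) i j ∧ loSum (layer k 0 s.F) i j < 2 * q)
    (hne : (layer k 0 s.F).Nonempty) :
    ∃ dstar ∈ layer k 0 (step q j b s).F,
      dstar j + q = loSum (layer k 0 s.F) i j ∧
      dstar i ≤ sm (layer k 0 s.F) i j + lo (layer k 0 (step q j b s).F) i := by
  classical
  set S := layer k 0 s.F with hS
  set n₀ := loSum S i j with hn₀def
  set x₀ := lo S i with hx₀def
  set y₀ := lo S j with hy₀def
  obtain ⟨d₁, hd₁S, hd₁⟩ := exists_loSum_eq hne i j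
  have hd₁F : d₁ ∈ s.F.support := (Finset.mem_filter.mp hd₁S).1
  have hd₁k : d₁ k = 0 := (Finset.mem_filter.mp hd₁S).2
  have hn₀ : q ≤ n₀ := by
    have h1 := hF d₁ hd₁F
    have h2 := degree_three hij hjk hik d₁
    omega
  have hxy : x₀ + y₀ ≤ n₀ := lo_add_lo_le_loSum i j
  have hsm : sm S i j = n₀ - x₀ - y₀ := rfl
  by_cases hbi : b i = 0
  · -- untranslated: the row is transported, `d₁ ↦ chartExponent q j d₁`
    have hb0 : b = 0 := by
      funext l
      rcases fin3_cases ⟨hij, hjk, hik⟩ l with rfl | rfl | rfl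
      · exact hbi
      · exact hbj
      · exact hbk
    subst hb0
    have hmem : chartExponent q j d₁ ∈ layer k 0 (step q j (0 : Fin 3 → K) s).F :=
      chartExponent_mem_layer_step_of_clean hij hjk hik q s hF hclean hd₁S
    refine ⟨_, hmem, ?_, ?_⟩
    · rw [chartExponent_self]
      have h2 := degree_three hij hjk hik d₁
      have h1 := hF d₁ hd₁F
      omega
    · rw [chartExponent_i hij]
      have h2 : y₀ ≤ d₁ j := lo_le hd₁S j
      have h3 : x₀ ≤ lo (layer k 0 (step q j (0 : Fin 3 → K) s).F) i := by
        apply le_lo ⟨_, hmem⟩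
        intro d' hd'
        obtain ⟨d, hd, -, -, h4⟩ := origin_of_mem_layer_step hij hjk hik q 0 rfl rfl s hF hd'
        rw [h4 rfl]
        exact lo_le hd i
      omega
  · -- translated: `Q = (X + β)^{x₀} · Q̃`, `deg Q̃ ≤ n₀ − x₀ − y₀`, on the row `u_j^{n₀ − q}`, `0 < n₀ − q < q`
    obtain ⟨hlo, hhi⟩ := hrange hbi
    have hrow : d₁ ∈ S.filter (fun d => d i + d j = n₀) := Finset.mem_filter.mpr ⟨hd₁S, hd₁⟩
    set Q := rowPoly i j k 0 n₀ (b i) s.F with hQ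
    have hQ0 : Q ≠ 0 := rowPoly_ne_zero hij hjk hik (b i) ⟨d₁, hrow⟩
    set lstar := Q.natTrailingDegree with hl
    have hcoef : Q.coeff lstar ≠ 0 := mt Polynomial.coeff_natTrailingDegree_eq_zero.mp hQ0
    have hmem : exp3 i j k lstar (n₀ - q) 0 ∈ layer k 0 (step q j b s).F := by
      rw [mem_layer, coeff_step_row_zero hij hjk hik q b hbj hbk s hF hn₀
        (not_isPthPowerExponent_exp3 hij hjk (by omega) (by omega)), exp3_k hjk hik]
      exact ⟨hcoef, rfl⟩
    refine ⟨_, hmem, ?_, ?_⟩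
    · rw [exp3_j hij hjk]
      omega
    · rw [exp3_i hij hik]
      show lstar ≤ sm S i j + lo (layer k 0 (step q j b s).F) i
      set R := S.filter (fun d => d i + d j = n₀) with hR
      set L : Polynomial K := Polynomial.X + Polynomial.C (b i) with hL
      set Qt : Polynomial K := ∑ d ∈ R, Polynomial.C (coeff d s.F) * L ^ (d i - x₀) with hQt
      have hfac : Q = L ^ x₀ * Qt := by
        rw [hQ, hQt, Finset.mul_sum]
        unfold rowPoly
        refine Finset.sum_congr rfl fun d hd => ?_
        have hx : x₀ ≤ d i := lo_le (Finset.mem_filter.mp hd).1 i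
        obtain ⟨m, hm⟩ := Nat.exists_eq_add_of_le hx
        rw [← hL, hm, Nat.add_sub_cancel_left, pow_add]
        ring
      have hL0 : L ^ x₀ ≠ 0 := pow_ne_zero _ (Polynomial.X_add_C_ne_zero (b i))
      have hQt0 : Qt ≠ 0 := by
        intro h
        rw [h, mul_zero] at hfac
        exact hQ0 hfac
      have htr : lstar = (L ^ x₀).natTrailingDegree + Qt.natTrailingDegree := by
        rw [hl, hfac, Polynomial.natTrailingDegree_mul hL0 hQt0]
      have hL1 : (L ^ x₀).natTrailingDegree = 0 := by
        apply Polynomial.natTrailingDegree_eq_zero.mpr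
        right
        rw [hL, Polynomial.coeff_X_add_C_pow]
        simp [hbi]
      have hdeg : Qt.natDegree ≤ n₀ - x₀ - y₀ := by
        rw [hQt]
        apply Polynomial.natDegree_sum_le_of_forall_le
        intro d hd
        have hy : y₀ ≤ d j := lo_le (Finset.mem_filter.mp hd).1 j
        have hs : d i + d j = n₀ := (Finset.mem_filter.mp hd).2
        calc (Polynomial.C (coeff d s.F) * L ^ (d i - x₀)).natDegree
            ≤ (L ^ (d i - x₀)).natDegree := Polynomial.natDegree_C_mul_le _ _
          _ ≤ (d i - x₀) * L.natDegree := Polynomial.natDegree_pow_le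
          _ ≤ n₀ - x₀ - y₀ := by rw [hL, Polynomial.natDegree_X_add_C]; omega
      have := Polynomial.natTrailingDegree_le_natDegree Qt
      omega

/-! ### The two inequalities of the strict multiplicity of the WALL LAYER `0` under planar moves (state level) -/

/-- **MONOTONICITY ON THE WALL LAYER `0` (PROVED).**  For a cleaned state whose translated moves happen in the order
window `q < n₀ < 2q`, the strict multiplicity of the wall layer `0` does not increase under a planar move. [new]
[folklore] -/
theorem sm_zero_step_le (q : ℕ) (b : Fin 3 → K) (hbj : b j = 0) (hbk : b k = 0) (s : State (Fin 3) K)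
    (hF : ∀ d ∈ s.F.support, q ≤ d.degree) (hclean : deletePthPowers q s.F = s.F)
    (hrange : b i ≠ 0 → q < loSum (layer k 0 s.F) i j ∧ loSum (layer k 0 s.F) i j < 2 * q) :
    sm (layer k 0 (step q j b s).F) i j ≤ sm (layer k 0 s.F) i j := by
  classical
  by_cases hne : (layer k 0 s.F).Nonempty
  · obtain ⟨dstar, hmem, hj', hi'⟩ := exists_low_exponent_zero hij hjk hik q b hbj hbk s hF hclean hrange hne
    have h2 : lo (layer k 0 (step q j b s).F) j ≤ dstar j := lo_le hmem j
    have h3 : loSum (layer k 0 (step q j b s).F) i j ≤ dstar i + dstar j := loSum_le hmem i j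
    have h4 : lo (layer k 0 (step q j b s).F) i + lo (layer k 0 (step q j b s).F) j ≤
        loSum (layer k 0 (step q j b s).F) i j := lo_add_lo_le_loSum i j
    have h5 : loSum (layer k 0 s.F) i j - q ≤ lo (layer k 0 (step q j b s).F) j := by
      apply le_lo ⟨_, hmem⟩
      intro d' hd'
      obtain ⟨d, hd, hline, -, -⟩ := origin_of_mem_layer_step hij hjk hik q b hbj hbk s hF hd'
      have := loSum_le hd i j
      omega
    have hxy : lo (layer k 0 s.F) i + lo (layer k 0 s.F) j ≤ loSum (layer k 0 s.F) i j := lo_add_lo_le_loSum i j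
    unfold sm at hi' ⊢
    omega
  · rw [Finset.not_nonempty_iff_eq_empty] at hne
    rw [layer_step_eq_empty hij hjk hik q b hbj hbk s hF hne, hne]

/-- **PROXIMITY INEQUALITY ON THE WALL LAYER `0` (PROVED).**  A planar move (translated only inside the order window)
followed by an UNTRANSLATED planar move in the OTHER chart: `sm'' + sm' ≤ sm` for the wall layer `0` of cleaned states.
[new] [folklore] -/
theorem sm_zero_step_step_le (q : ℕ) (b : Fin 3 → K) (hbj : b j = 0) (hbk : b k = 0) (s : State (Fin 3) K)
    (hF : ∀ d ∈ s.F.support, q ≤ d.degree) (hF' : ∀ d ∈ (step q j b s).F.support, q ≤ d.degree)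
    (hclean : deletePthPowers q s.F = s.F) (hclean' : deletePthPowers q (step q j b s).F = (step q j b s).F)
    (hrange : b i ≠ 0 → q < loSum (layer k 0 s.F) i j ∧ loSum (layer k 0 s.F) i j < 2 * q) :
    sm (layer k 0 (step q i (0 : Fin 3 → K) (step q j b s)).F) i j + sm (layer k 0 (step q j b s).F) i j ≤
      sm (layer k 0 s.F) i j := by
  classical
  by_cases hne : (layer k 0 s.F).Nonempty
  · obtain ⟨dstar, hmem, hj', hi'⟩ := exists_low_exponent_zero hij hjk hik q b hbj hbk s hF hclean hrange hne
    have h2 : lo (layer k 0 (step q j b s).F) j ≤ dstar j := lo_le hmem j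
    have h4 : lo (layer k 0 (step q j b s).F) i + lo (layer k 0 (step q j b s).F) j ≤
        loSum (layer k 0 (step q j b s).F) i j := lo_add_lo_le_loSum i j
    have h5 : loSum (layer k 0 s.F) i j - q ≤ lo (layer k 0 (step q j b s).F) j := by
      apply le_lo ⟨_, hmem⟩
      intro d' hd'
      obtain ⟨d, hd, hline, -, -⟩ := origin_of_mem_layer_step hij hjk hik q b hbj hbk s hF hd'
      have := loSum_le hd i j
      omega
    have hxy : lo (layer k 0 s.F) i + lo (layer k 0 s.F) j ≤ loSum (layer k 0 s.F) i j := lo_add_lo_le_loSum i j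
    -- the second (untranslated) move, chart `u_i`: roles `(j, i, k)`; the intermediate state is cleaned
    have hmem2 : chartExponent q i dstar ∈ layer k 0 (step q i (0 : Fin 3 → K) (step q j b s)).F :=
      chartExponent_mem_layer_step_of_clean hij.symm hik hjk q (step q j b s) hF' hclean' hmem
    have hdi : chartExponent q i dstar i + q = dstar i + dstar j := by
      rw [chartExponent_self]
      have h6 := hF' dstar (Finset.mem_filter.mp hmem).1
      have h7 := degree_three hij hjk hik dstar
      have h8 : dstar k = 0 := (Finset.mem_filter.mp hmem).2
      omega
    have hdj : chartExponent q i dstar j = dstar j := chartExponent_i hij.symm q dstar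
    have h9 : loSum (layer k 0 (step q i (0 : Fin 3 → K) (step q j b s)).F) i j ≤
        chartExponent q i dstar i + chartExponent q i dstar j := loSum_le hmem2 i j
    have h10 : lo (layer k 0 (step q i (0 : Fin 3 → K) (step q j b s)).F) i +
        lo (layer k 0 (step q i (0 : Fin 3 → K) (step q j b s)).F) j ≤
        loSum (layer k 0 (step q i (0 : Fin 3 → K) (step q j b s)).F) i j := lo_add_lo_le_loSum i j
    have hls : loSum (layer k 0 (step q j b s).F) i j ≤ dstar i + dstar j := loSum_le hmem i j
    have hq' : q ≤ loSum (layer k 0 (step q j b s).F) i j := by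
      obtain ⟨d', hd', hd'eq⟩ := exists_loSum_eq ⟨_, hmem⟩ i j
      have h6 := hF' d' (Finset.mem_filter.mp hd').1
      have h7 := degree_three hij hjk hik d'
      have h8 : d' k = 0 := (Finset.mem_filter.mp hd').2
      omega
    have h11 : loSum (layer k 0 (step q j b s).F) i j - q ≤
        lo (layer k 0 (step q i (0 : Fin 3 → K) (step q j b s)).F) i := by
      apply le_lo ⟨_, hmem2⟩
      intro d'' hd''
      obtain ⟨d', hd', hline, -, -⟩ :=
        origin_of_mem_layer_step hij.symm hik hjk q (0 : Fin 3 → K) rfl rfl (step q j b s) hF' hd''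
      have := loSum_le hd' i j
      omega
    have h12 : lo (layer k 0 (step q j b s).F) j ≤ lo (layer k 0 (step q i (0 : Fin 3 → K) (step q j b s)).F) j := by
      apply le_lo ⟨_, hmem2⟩
      intro d'' hd''
      obtain ⟨d', hd', -, -, heq⟩ :=
        origin_of_mem_layer_step hij.symm hik hjk q (0 : Fin 3 → K) rfl rfl (step q j b s) hF' hd''
      rw [heq rfl]
      exact lo_le hd' j
    unfold sm at hi' ⊢
    omega
  · rw [Finset.not_nonempty_iff_eq_empty] at hne
    have h1 := layer_step_eq_empty hij hjk hik q b hbj hbk s hF hne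
    have h2 := layer_step_eq_empty hij.symm hik hjk q (0 : Fin 3 → K) rfl rfl (step q j b s) hF' h1
    rw [h1, h2, hne, sm_empty]

/-! ### The order window: a heavy wall layer `0` over dead live layers makes a translated move fat -/

/-- **FATNESS FROM A HEAVY WALL LAYER `0` (PROVED).**  If every exponent of the wall layer `0` has degree `≥ 2q`
and every layer `1 … q−1` is MONOMIAL-LED, then after a TRANSLATED planar move (`b_i ≠ 0`) every monomial of the new
state has `d_j + d_k ≥ q` (`PlanarCut.fat_of_dead_layers` is the case «layer `0` empty»). [new] [folklore] -/
theorem fat_of_heavy_layer_zero (q : ℕ) (b : Fin 3 → K) (hbj : b j = 0) (hbk : b k = 0) (hbi : b i ≠ 0)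
    (s : State (Fin 3) K) (hF : ∀ d ∈ s.F.support, q ≤ d.degree)
    (hF' : ∀ d ∈ (step q j b s).F.support, q ≤ d.degree) (hheavy : ∀ d ∈ layer k 0 s.F, 2 * q ≤ d i + d j)
    (hdead : ∀ a, 1 ≤ a → a < q → sm (layer k a s.F) i j = 0) :
    ∀ d' ∈ (step q j b s).F.support, q ≤ (Finsupp.erase i d').degree := by
  classical
  intro d' hd'
  have hdeg := degree_erase_add d' i
  have h3 := degree_three hij hjk hik d'
  obtain ⟨a, ha⟩ : ∃ a, d' k = a := ⟨_, rfl⟩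
  by_cases haq : a < q
  · rcases Nat.eq_zero_or_pos a with ha0 | ha1
    · have hmem : d' ∈ layer k 0 (step q j b s).F :=
        mem_layer.mpr ⟨MvPolynomial.mem_support_iff.mp hd', by rw [ha, ha0]⟩
      obtain ⟨d, hd, hline, -, -⟩ := origin_of_mem_layer_step hij hjk hik q b hbj hbk s hF hmem
      have h6 := hheavy d hd
      omega
    · have hmem : d' ∈ layer k a (step q j b s).F := mem_layer.mpr ⟨MvPolynomial.mem_support_iff.mp hd', ha⟩
      have hne : (layer k a s.F).Nonempty := by
        by_contra hne
        rw [Finset.not_nonempty_iff_eq_empty] at hne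
        rw [layer_step_eq_empty hij hjk hik q b hbj hbk s hF hne] at hmem
        exact absurd hmem (Finset.notMem_empty _)
      obtain ⟨d₁, hd₁S, hd₁⟩ := exists_loSum_eq hne i j
      have hq : q ≤ loSum (layer k a s.F) i j + a := by
        have h1 := hF d₁ (Finset.mem_filter.mp hd₁S).1
        have h2 := degree_three hij hjk hik d₁
        have h4 : d₁ k = a := (Finset.mem_filter.mp hd₁S).2
        omega
      have hsm := hdead a ha1 haq
      have hxy : lo (layer k a s.F) i + lo (layer k a s.F) j ≤ loSum (layer k a s.F) i j :=
        lo_add_lo_le_loSum i j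
      have hrow : ∀ d ∈ (layer k a s.F).filter (fun d => d i + d j = loSum (layer k a s.F) i j), d = d₁ := by
        intro d hd
        have hd0 := (Finset.mem_filter.mp hd)
        have e1 := lo_le hd0.1 i
        have e2 := lo_le hd0.1 j
        have e3 := lo_le hd₁S i
        have e4 := lo_le hd₁S j
        unfold sm at hsm
        exact eq_of_row hij hjk hik hd (Finset.mem_filter.mpr ⟨hd₁S, hd₁⟩) (by omega)
      have hc0 : (rowPoly i j k a (loSum (layer k a s.F) i j) (b i) s.F).coeff 0 ≠ 0 := by
        rw [coeff_rowPoly, Finset.sum_eq_single d₁]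
        · rw [Nat.choose_zero_right, Nat.cast_one, one_mul, Nat.sub_zero]
          exact mul_ne_zero (MvPolynomial.mem_support_iff.mp (Finset.mem_filter.mp hd₁S).1) (pow_ne_zero _ hbi)
        · intro d hd hne'
          exact absurd (hrow d hd) hne'
        · intro h'
          exact absurd (Finset.mem_filter.mpr ⟨hd₁S, hd₁⟩) h'
      have hpure : exp3 i j k 0 (loSum (layer k a s.F) i j + a - q) a ∈ (step q j b s).F.support := by
        rw [MvPolynomial.mem_support_iff, coeff_step_lowest_row hij hjk hik q b hbj hbk s hF ha1 haq hq]
        exact hc0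
      have h5 := hF' _ hpure
      rw [degree_three hij hjk hik, exp3_i hij hik, exp3_j hij hjk, exp3_k hjk hik] at h5
      obtain ⟨d, hd, hline, -, -⟩ := origin_of_mem_layer_step hij hjk hik q b hbj hbk s hF hmem
      have h6 := loSum_le hd i j
      omega
  · omega

end Planar

end Summit.ResolutionOfSingularities.ResolutionOfSingularities.Theorems.GhostDescent
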